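import Literature.NumberTheory.EllipticCurves.LocalUniversalNorms
import HarnessLib

/-!
# Universal norms along a `ℤ_p`-tower seen at a completion: transport TOOLS (equivariant isomorphisms,
# norms over a subgroup vs. over `Γ_E`, conjugation, odd-index bookkeeping)

HONEST FRAMING (cell `bsd-addord`, `run/shared/lean/pub/bsd-addord/README.md` §4; seat
`bsd-addord-twist`, strategy = twist transport; target T-ANOM, route R1, item (T3) of TARGET.md S36‴/S41):
the programme's target of record is the full Birch–Swinnerton-Dyer formula for every `E/ℚ` of analytic
rank `≤ 1`; this file is a TOOL file for the kernel lemma (T3) «the universal-norm index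
`[E(ℚ_p) : N_∞E(ℚ_p)]` of Delbourgo 2002 (p. 67 (iv), p. 69) is prime to `p` on the additive twist
`E = V ⊗ χ_{p*}` of a good ordinary `V`» (`UniversalNormTwistTransport.lean`,
`UniversalNormTwistTransportRat.lean`). Theorems only; no definition, no named fact, no `sorry`,
nothing asserted about any curve.

## What (objects of `Literature/NumberTheory/EllipticCurves/LocalUniversalNorms.lean`: for `W/K`, a
## `K`-field `E`, `U ≤ Γ_E`: `localFixedPoints W E U = E(K̄_E)^U`, `localNorm U U'`, `localLayer E κ U n`,
## `localUniversalNorms E κ U`, `localUniversalNormIndex E κ U`)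

* §1 A `Γ_E`-equivariant isomorphism `φ : E_X(K̄_E) ≃+ E_Y(K̄_E)` (e.g. a change of variables over `K`)
  identifies fixed points, finite-layer norms, universal norms and their indices
  (`localUniversalNormIndex_eq`).
* §2 The layer `Γ_n = localLayer E κ ⊤ n` is normal of index dividing `pⁿ`; for `S ≤ Γ_E` with
  `S · Γ_n = Γ_E` and an additive map `g` commuting with `S`: on `Γ_n`-fixed points,
  **`g ∘ N_{Γ_E/Γ_n} = N_{S/S_n} ∘ g`** (`map_localNorm_top_eq_localNorm`: coset representatives of
  `Γ_E/Γ_n` may be chosen in `S`); with `g = id`, the norm over `S` IS the norm over `Γ_E`.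
* §3 `N_{U/U'}(τ • P) = τ • N_{U/U'}(P)` for `U, U'` normal (`coe_localNorm_smul`).
* §4 In an abelian group a subgroup of ODD finite index contains every `a` with `2a` in it
  (`mem_of_two_nsmul_mem_of_odd_index`); a counting lemma (`exists_sub_map_mem_of_index_eq`).

References: B. Mazur, Invent. Math. 18 (1972) 183–266, §4 (4.31)–(4.33) (the norm `N_{L/K}`, universal
norms) [Mazur1972Towers]; J.-P. Serre, *Local Fields*, VII §5–§7 (norm/corestriction as a coset sum).
-/

noncomputable section

open scoped Classical

universe u

namespace Summit.BirchSwinnertonDyer.Rank1Residual.Additive.UniversalNormTwist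

open WeierstrassCurve Field Literature.NumberTheory.EllipticCurves

variable {K : Type u} [Field K] {X Y : WeierstrassCurve K} {E : Type u} [Field E] [Algebra K E]

/-! ## §1 `Γ_E`-equivariant isomorphisms of local points transport fixed points, norms and
universal norms -/

section Equivariant

variable (φ : localPoints X E ≃+ localPoints Y E)
  (hφ : ∀ (σ : absoluteGaloisGroup E) (P : localPoints X E), φ (σ • P) = σ • φ P)

include hφ in
/-- The inverse of an equivariant isomorphism is equivariant. [folklore] -/
theorem symm_smul (σ : absoluteGaloisGroup E) (Q : localPoints Y E) :
    φ.symm (σ • Q) = σ • φ.symm Q := by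
  apply φ.injective
  rw [hφ, φ.apply_symm_apply, φ.apply_symm_apply]

include hφ in
/-- An equivariant isomorphism preserves the fixed points of every subgroup. [folklore] -/
theorem map_mem_localFixedPoints_iff (U : Subgroup (absoluteGaloisGroup E)) (P : localPoints X E) :
    φ P ∈ localFixedPoints Y E U ↔ P ∈ localFixedPoints X E U := by
  simp only [mem_localFixedPoints_iff, ← hφ, φ.injective.eq_iff]

include hφ in
/-- An equivariant isomorphism commutes with the finite-layer norms. [folklore] -/
theorem coe_localNorm_map (U U' : Subgroup (absoluteGaloisGroup E)) [(U'.subgroupOf U).FiniteIndex]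
    (P : localPoints X E) (hP : P ∈ localFixedPoints X E U') :
    ((localNorm (W := Y) U U' ⟨φ P, (map_mem_localFixedPoints_iff φ hφ U' P).mpr hP⟩ :
        localFixedPoints Y E U) : localPoints Y E) =
      φ ((localNorm (W := X) U U' ⟨P, hP⟩ : localFixedPoints X E U) : localPoints X E) := by
  rw [coe_localNorm_apply, coe_localNorm_apply, map_sum]
  refine Finset.sum_congr rfl fun q _ ↦ ?_
  induction q using QuotientGroup.induction_on with
  | H g => rw [normSummand_mk, normSummand_mk, hφ]

variable {p : ℕ} [Fact p.Prime] (κ : ZpExtension K p)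

include hφ in
/-- An equivariant isomorphism maps universal norms to universal norms. [folklore] -/
theorem map_mem_localUniversalNorms (U : Subgroup (absoluteGaloisGroup E)) {P : localPoints X E}
    (hP : P ∈ localFixedPoints X E U)
    (hN : (⟨P, hP⟩ : localFixedPoints X E U) ∈ localUniversalNorms E κ U (W := X)) :
    (⟨φ P, (map_mem_localFixedPoints_iff φ hφ U P).mpr hP⟩ : localFixedPoints Y E U) ∈
      localUniversalNorms E κ U (W := Y) := by
  rw [mem_localUniversalNorms_iff] at hN ⊢
  intro n
  obtain ⟨Q, hQ⟩ := hN n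
  refine ⟨⟨φ Q, (map_mem_localFixedPoints_iff φ hφ _ (Q : localPoints X E)).mpr Q.2⟩, Subtype.ext ?_⟩
  rw [coe_localNorm_map φ hφ U _ (Q : localPoints X E) Q.2, Subtype.coe_eta, hQ]

include φ hφ in
/-- **Equivariantly isomorphic local points have the same universal norm index** (for every subgroup
`U ≤ Γ_E`): the induced isomorphism of `U`-fixed points carries `N_∞` onto `N_∞`. [folklore] -/
theorem localUniversalNormIndex_eq (U : Subgroup (absoluteGaloisGroup E)) :
    localUniversalNormIndex E κ U (W := X) = localUniversalNormIndex E κ U (W := Y) := by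
  let e : localFixedPoints X E U ≃+ localFixedPoints Y E U :=
    { toFun := fun P ↦ ⟨φ P, (map_mem_localFixedPoints_iff φ hφ U P).mpr P.2⟩
      invFun := fun Q ↦ ⟨φ.symm Q, (map_mem_localFixedPoints_iff φ.symm (symm_smul φ hφ) U Q).mpr Q.2⟩
      left_inv := fun P ↦ Subtype.ext (φ.symm_apply_apply _)
      right_inv := fun Q ↦ Subtype.ext (φ.apply_symm_apply _)
      map_add' := fun P Q ↦ Subtype.ext (map_add φ _ _) }
  have hmap : (localUniversalNorms E κ U (W := X)).map e.toAddMonoidHom =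
      localUniversalNorms E κ U (W := Y) := by
    ext Q
    constructor
    · rintro ⟨P, hP, rfl⟩
      exact map_mem_localUniversalNorms φ hφ κ U P.2 hP
    · intro hQ
      exact ⟨⟨φ.symm Q, (map_mem_localFixedPoints_iff φ.symm (symm_smul φ hφ) U Q).mpr Q.2⟩,
        map_mem_localUniversalNorms φ.symm (symm_smul φ hφ) κ U Q.2 hQ,
        Subtype.ext (φ.apply_symm_apply _)⟩
  rw [localUniversalNormIndex, localUniversalNormIndex, ← hmap,
    AddSubgroup.index_map_of_bijective e.bijective]

end Equivariant

/-! ## §2 The layers seen from a subgroup; the norm over `S` versus the norm over `Γ_E` -/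

section Layers

variable (X E) {p : ℕ} [Fact p.Prime] (κ : ZpExtension K p) (S : Subgroup (absoluteGaloisGroup E))
  (n : ℕ)

/-- The `n`-th layer seen from `⊤` is the local subgroup of the global layer. [folklore] -/
theorem localLayer_top : localLayer E κ ⊤ n = localSubgroup (κ.layerSubgroup n) E :=
  top_inf_eq _

/-- The layer seen from `S` is `S ∩` (the layer seen from `⊤`). [folklore] -/
theorem localLayer_eq_inf : localLayer E κ S n = S ⊓ localLayer E κ ⊤ n := by
  rw [localLayer_top]; rfl

/-- The layer seen from `S` lies in the layer seen from `⊤`. [folklore] -/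
theorem localLayer_le_localLayer_top : localLayer E κ S n ≤ localLayer E κ ⊤ n := by
  rw [localLayer_eq_inf]; exact inf_le_right

/-- The layer seen from `⊤` is a normal subgroup of `Γ_E`. [folklore] -/
theorem normal_localLayer_top : (localLayer E κ ⊤ n).Normal := by
  rw [localLayer_top, localSubgroup_eq_comap]
  infer_instance

/-- The index of the `n`-th layer divides `pⁿ`. [folklore] -/
theorem index_localLayer_top_dvd : (localLayer E κ ⊤ n).index ∣ p ^ n := by
  rw [localLayer_top, localSubgroup_eq_comap, Subgroup.index_comap, ← κ.index_layerSubgroup n]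
  exact Subgroup.relIndex_dvd_index_of_normal _ _

/-- The `n`-th layer has finite index in `Γ_E`. [folklore] -/
theorem finiteIndex_localLayer_top : (localLayer E κ ⊤ n).FiniteIndex := by
  refine ⟨fun h ↦ ?_⟩
  have hd := index_localLayer_top_dvd E κ n
  rw [h, zero_dvd_iff] at hd
  exact pow_ne_zero n (Fact.out : p.Prime).ne_zero hd

variable {E κ S n}

/-- A point fixed by the layer seen from `⊤` is fixed by the layer seen from `S`. [folklore] -/
theorem mem_localFixedPoints_localLayer_of_top {P : localPoints X E}
    (hP : P ∈ localFixedPoints X E (localLayer E κ ⊤ n)) :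
    P ∈ localFixedPoints X E (localLayer E κ S n) :=
  localFixedPoints_antitone (localLayer_le_localLayer_top E κ S n) hP

variable {X}

/-- **`g ∘ N_{Γ_E/Γ_n} = N_{S/S_n} ∘ g` when `S · Γ_n = Γ_E`.** For an additive map `g` of local points
commuting with the action of `S`, a point `P` fixed by the layer `Γ_n` with `g P` fixed by
`S_n = S ∩ Γ_n`: `g (Σ_{Γ_E/Γ_n} γ • P) = Σ_{S/S_n} s • g P` — the comparison map of coset spaces
`S / S_n → Γ_E / Γ_n` is a bijection (injective as `S ∩ Γ_n = S_n`, surjective as `S · Γ_n = Γ_E`).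
[folklore] -/
theorem map_localNorm_top_eq_localNorm {X' : WeierstrassCurve K} (g : localPoints X' E →+ localPoints X E)
    (hg : ∀ s ∈ S, ∀ Q : localPoints X' E, g (s • Q) = s • g Q)
    (hSL : ∀ γ : absoluteGaloisGroup E, ∃ s ∈ S, ∃ l ∈ localLayer E κ ⊤ n, γ = s * l)
    (P : localPoints X' E) (hP : P ∈ localFixedPoints X' E (localLayer E κ ⊤ n))
    (hgP : g P ∈ localFixedPoints X E (localLayer E κ S n)) :
    g ((localNorm (W := X') ⊤ (localLayer E κ ⊤ n) ⟨P, hP⟩ : localFixedPoints X' E ⊤) :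
        localPoints X' E) =
      ((localNorm (W := X) S (localLayer E κ S n) ⟨g P, hgP⟩ : localFixedPoints X E S) :
        localPoints X E) := by
  -- the comparison map of coset spaces `S / S_n → Γ_E / Γ_n`
  let ψ : S ⧸ (localLayer E κ S n).subgroupOf S →
      (⊤ : Subgroup (absoluteGaloisGroup E)) ⧸ (localLayer E κ ⊤ n).subgroupOf ⊤ :=
    Quotient.map' (fun s ↦ ⟨(s : absoluteGaloisGroup E), Subgroup.mem_top _⟩) (by
      intro a b hab
      rw [QuotientGroup.leftRel_apply] at hab ⊢
      rw [Subgroup.mem_subgroupOf] at hab ⊢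
      exact localLayer_le_localLayer_top E κ S n hab)
  have hψ_mk : ∀ s : S, ψ (QuotientGroup.mk s) =
      QuotientGroup.mk ⟨(s : absoluteGaloisGroup E), Subgroup.mem_top _⟩ := fun _ ↦ rfl
  have hψ : Function.Bijective ψ := by
    refine ⟨fun a b hab ↦ ?_, fun q ↦ ?_⟩
    · induction a using QuotientGroup.induction_on with
      | H a =>
        induction b using QuotientGroup.induction_on with
        | H b =>
          rw [hψ_mk, hψ_mk, QuotientGroup.eq, Subgroup.mem_subgroupOf] at hab
          rw [QuotientGroup.eq, Subgroup.mem_subgroupOf, localLayer_eq_inf]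
          exact ⟨S.mul_mem (S.inv_mem a.2) b.2, by simpa using hab⟩
    · induction q using QuotientGroup.induction_on with
      | H γ =>
        obtain ⟨s, hs, l, hl, hγ⟩ := hSL γ
        refine ⟨QuotientGroup.mk ⟨s, hs⟩, ?_⟩
        rw [hψ_mk, QuotientGroup.eq, Subgroup.mem_subgroupOf]
        simpa [hγ] using hl
  rw [coe_localNorm_apply, coe_localNorm_apply, map_sum]
  symm
  refine Fintype.sum_bijective ψ hψ _ _ fun q ↦ ?_
  induction q using QuotientGroup.induction_on with
  | H s => rw [hψ_mk, normSummand_mk, normSummand_mk, hg _ s.2]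

/-- **The norm over `K_𝔭` restricted to `ℚ_{p,n}`-points is the norm over `ℚ_p`** (the case `g = id`
of `map_localNorm_top_eq_localNorm`). [folklore] -/
theorem coe_localNorm_eq_coe_localNorm_top
    (hSL : ∀ γ : absoluteGaloisGroup E, ∃ s ∈ S, ∃ l ∈ localLayer E κ ⊤ n, γ = s * l)
    (P : localPoints X E) (hP : P ∈ localFixedPoints X E (localLayer E κ ⊤ n)) :
    ((localNorm (W := X) S (localLayer E κ S n) ⟨P, mem_localFixedPoints_localLayer_of_top X hP⟩ :
        localFixedPoints X E S) : localPoints X E) =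
      ((localNorm (W := X) ⊤ (localLayer E κ ⊤ n) ⟨P, hP⟩ :
        localFixedPoints X E ⊤) : localPoints X E) :=
  (map_localNorm_top_eq_localNorm (AddMonoidHom.id _) (fun _ _ _ ↦ rfl) hSL P hP
    (mem_localFixedPoints_localLayer_of_top X hP)).symm

end Layers

/-! ## §3 Conjugation: `N_{U/U'}(τ • P) = τ • N_{U/U'}(P)` for `U, U'` normal -/

section Conj

variable (X) (U U' : Subgroup (absoluteGaloisGroup E)) [hU : U.Normal] [hU' : U'.Normal]
  (τ : absoluteGaloisGroup E)

omit hU in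
/-- A translate of a `U'`-fixed point by any `τ ∈ Γ_E` is again `U'`-fixed when `U'` is normal.
[folklore] -/
theorem smul_mem_localFixedPoints_of_normal {P : localPoints X E}
    (hP : P ∈ localFixedPoints X E U') : τ • P ∈ localFixedPoints X E U' := by
  intro σ hσ
  have h : τ⁻¹ * σ * τ ∈ U' := by
    have := hU'.conj_mem σ hσ τ⁻¹
    simpa using this
  calc σ • τ • P = τ • ((τ⁻¹ * σ * τ) • P) := by
          rw [← mul_smul, ← mul_smul]; congr 1; group
    _ = τ • P := by rw [hP _ h]

variable [(U'.subgroupOf U).FiniteIndex]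

/-- **`N_{U/U'}(τ • P) = τ • N_{U/U'}(P)`** for `U, U'` normal in `Γ_E` and any `τ ∈ Γ_E`
(reindex the sum over `U/U'` by the conjugation `u ↦ τ⁻¹ u τ`). [folklore] -/
theorem coe_localNorm_smul (P : localPoints X E) (hP : P ∈ localFixedPoints X E U') :
    ((localNorm (W := X) U U' ⟨τ • P, smul_mem_localFixedPoints_of_normal X U' τ hP⟩ :
        localFixedPoints X E U) : localPoints X E) =
      τ • ((localNorm (W := X) U U' ⟨P, hP⟩ : localFixedPoints X E U) : localPoints X E) := by
  -- conjugation by `τ` on `U` and on the coset space `U / (U ∩ U')`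
  let c : U → U := fun u ↦ ⟨τ⁻¹ * u * τ, by have := hU.conj_mem u u.2 τ⁻¹; simpa using this⟩
  have hc : ∀ u : U, ((c u : U) : absoluteGaloisGroup E) = τ⁻¹ * u * τ := fun _ ↦ rfl
  let ψ : U ⧸ U'.subgroupOf U → U ⧸ U'.subgroupOf U := Quotient.map' c (by
    intro a b hab
    rw [QuotientGroup.leftRel_apply, Subgroup.mem_subgroupOf] at hab ⊢
    rw [Subgroup.coe_mul, Subgroup.coe_inv, hc, hc]
    have := hU'.conj_mem _ hab τ⁻¹
    simp only [Subgroup.coe_mul, Subgroup.coe_inv, inv_inv] at this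
    convert this using 1
    group)
  have hψ_mk : ∀ u : U, ψ (QuotientGroup.mk u) = QuotientGroup.mk (c u) := fun _ ↦ rfl
  have hψ : Function.Bijective ψ := by
    refine (Finite.injective_iff_bijective).mp fun a b hab ↦ ?_
    induction a using QuotientGroup.induction_on with
    | H a =>
      induction b using QuotientGroup.induction_on with
      | H b =>
        rw [hψ_mk, hψ_mk, QuotientGroup.eq, Subgroup.mem_subgroupOf, Subgroup.coe_mul,
          Subgroup.coe_inv, hc, hc] at hab
        rw [QuotientGroup.eq, Subgroup.mem_subgroupOf, Subgroup.coe_mul, Subgroup.coe_inv]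
        have := hU'.conj_mem _ hab τ
        convert this using 1
        group
  rw [coe_localNorm_apply, coe_localNorm_apply, Finset.smul_sum]
  rw [← hψ.sum_comp (fun q ↦ τ • normSummand U ⟨P, hP⟩ q)]
  refine Finset.sum_congr rfl fun q _ ↦ ?_
  induction q using QuotientGroup.induction_on with
  | H u =>
    rw [hψ_mk, normSummand_mk, normSummand_mk, hc, ← mul_smul, ← mul_smul]
    congr 1
    group

end Conj

/-! ## §4 Two lemmas on finite abelian groups of odd order -/

section OddIndex

/-- In an abelian group, a subgroup of finite ODD index contains every `a` with `2a` in it (the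
class of `a` has order dividing `gcd(2, index) = 1`). [folklore] -/
theorem mem_of_two_nsmul_mem_of_odd_index {A : Type*} [AddCommGroup A] (N : AddSubgroup A)
    (hodd : Odd N.index) {a : A} (h2 : (2 : ℕ) • a ∈ N) : a ∈ N := by
  rw [← QuotientAddGroup.eq_zero_iff] at h2 ⊢
  rw [QuotientAddGroup.mk_nsmul] at h2
  have hord : addOrderOf (QuotientAddGroup.mk a : A ⧸ N) ∣ 2 :=
    addOrderOf_dvd_iff_nsmul_eq_zero.mpr h2
  have hcard : addOrderOf (QuotientAddGroup.mk a : A ⧸ N) ∣ N.index := by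
    rw [AddSubgroup.index_eq_card]; exact addOrderOf_dvd_natCard _
  have h := Nat.dvd_gcd hord hcard
  rw [Nat.Coprime.gcd_eq_one (Nat.coprime_two_left.mpr hodd), Nat.dvd_one,
    AddMonoid.addOrderOf_eq_one_iff] at h
  exact h

/-- **Counting**: for `f : A → B`, subgroups `M ≤ A`, `N ≤ B` with `f⁻¹(N) = M` and the SAME finite
index, every class of `B/N` is hit by `A` (the induced injection `A/M ↪ B/N` of finite sets of equal
size is onto). [folklore] -/
theorem exists_sub_map_mem_of_index_eq {A B : Type*} [AddCommGroup A] [AddCommGroup B] (f : A →+ B)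
    (M : AddSubgroup A) (N : AddSubgroup B) (hMN : ∀ a, f a ∈ N ↔ a ∈ M)
    (hM : M.index = N.index) (hN0 : N.index ≠ 0) (b : B) : ∃ a : A, b - f a ∈ N := by
  let g : A ⧸ M →+ B ⧸ N := QuotientAddGroup.map M N f fun a ha ↦ (hMN a).mpr ha
  have hinj : Function.Injective g := by
    refine (injective_iff_map_eq_zero g).mpr fun q hq ↦ ?_
    induction q using QuotientAddGroup.induction_on with
    | H a =>
      rw [QuotientAddGroup.map_mk, QuotientAddGroup.eq_zero_iff, hMN] at hq
      exact (QuotientAddGroup.eq_zero_iff a).mpr hq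
  haveI : Finite (B ⧸ N) := Nat.finite_of_card_ne_zero (by rwa [← AddSubgroup.index_eq_card])
  have hbij : Function.Bijective g :=
    hinj.bijective_of_nat_card_le (by rw [← AddSubgroup.index_eq_card, ← AddSubgroup.index_eq_card, hM])
  obtain ⟨q, hq⟩ := hbij.2 (QuotientAddGroup.mk b)
  obtain ⟨a, rfl⟩ := QuotientAddGroup.mk_surjective q
  refine ⟨a, ?_⟩
  rw [QuotientAddGroup.map_mk, QuotientAddGroup.eq] at hq
  rwa [sub_eq_add_neg, add_comm]

end OddIndex

end Summit.BirchSwinnertonDyer.Rank1Residual.Additive.UniversalNormTwist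

end
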